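import Summits.ValiantsHypothesis.ValiantsHypothesis.Theorems.LiftNullstellensatzLiftWidthPerFourRungOneCore

/-!
# Route LiftNullstellensatz — `LiftWidthPerFour` (stmt-ValiantsHypothesis-5922), CASE A: the rung-1
ENGINE made abstract (three quadrics with the syzygy facts F1–F3 as hypotheses)

Helper `--supports stmt-ValiantsHypothesis-5922` (prover val-width-5922-p2 g0).  The core of rung 1
(`false_of_G1_blocks`, `…RungOneCore.lean`) refutes `Ā C̄ = 0`, `Ā c = q'`, `aᵀ C̄ = q'ᵀ` for LINEAR
`Ā ∈ R₁^{3×5}`, `C̄ ∈ R₁^{5×3}` and the specific triple `q' = (p₂₃, p₁₃, p₁₂)` of `2 × 2` permanents.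
The proof used exactly three facts about `q'`: (F1) no syzygy with linear coefficients, (F2) the
syzygies with quadratic coefficients are the Koszul ones, (F3) `q'_0 f = q'_1 g` with linear `f, g`
forces `g = 0` — plus `q'_0 ≠ 0`.  This file re-proves the engine for an ARBITRARY
triple `q : Fin 3 → K[σ]` satisfying (F1)–(F3) (`false_of_G1_blocks_of_facts`), so that the
remaining cases of `stub_caseA` (crux workfile `CASEA-RUNG1-p2.md` v2 §6: the factorisation
`G|_W = ÃC̃` on a LINEAR SECTION `W`, where `q` = the three permanents restricted to `W`) only have
to supply (F1)–(F3) for the restricted quadrics (they hold whenever the section is cut by a regular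
sequence on `K[Λ_c]/(q')`, §6).  The rung-1 instance is `false_of_G1_blocks` itself
(facts: `linSyzygy_eq_zero`, `quadSyzygy_koszul`, `eq_zero_of_perm_mul_eq_perm_mul`).  No new definitions.  VP ≠ VNP is not moved by this item.
-/

noncomputable section

open MvPolynomial Matrix Finset

namespace Summit.ValiantsHypothesis.LiftNullstellensatz

variable {K : Type*} [Field K] {σ : Type*}

/-- **`ℓ × m = 0` from `q · (ℓ × m) = 0`** for linear `ℓ, m ∈ K[σ]³`, given (F1) no linear syzygy and
(F2) Koszul quadratic syzygies of `q`. [folklore] -/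
theorem minors_eq_zero_of_cross_dot_eq_zero_of_facts (q : Fin 3 → MvPolynomial σ K)
    (hF1 : ∀ l₀ l₁ l₂ : MvPolynomial σ K, l₀.IsHomogeneous 1 → l₁.IsHomogeneous 1 →
      l₂.IsHomogeneous 1 → l₀ * q 0 + l₁ * q 1 + l₂ * q 2 = 0 → l₀ = 0 ∧ l₁ = 0 ∧ l₂ = 0)
    (hF2 : ∀ n₀ n₁ n₂ : MvPolynomial σ K, n₀.IsHomogeneous 2 → n₁.IsHomogeneous 2 →
      n₂.IsHomogeneous 2 → n₀ * q 0 + n₁ * q 1 + n₂ * q 2 = 0 → ∃ lam mu nu : K,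
        n₀ = C lam * q 1 + C mu * q 2 ∧ n₁ = -(C lam * q 0) + C nu * q 2 ∧
        n₂ = -(C mu * q 0) - C nu * q 1)
    (l₀ l₁ l₂ m₀ m₁ m₂ : MvPolynomial σ K)
    (hl₀ : l₀.IsHomogeneous 1) (hl₁ : l₁.IsHomogeneous 1) (hl₂ : l₂.IsHomogeneous 1)
    (hm₀ : m₀.IsHomogeneous 1) (hm₁ : m₁.IsHomogeneous 1) (hm₂ : m₂.IsHomogeneous 1)
    (h : (l₁ * m₂ - l₂ * m₁) * q 0 + (l₂ * m₀ - l₀ * m₂) * q 1 + (l₀ * m₁ - l₁ * m₀) * q 2 = 0) :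
    l₁ * m₂ - l₂ * m₁ = 0 ∧ l₂ * m₀ - l₀ * m₂ = 0 ∧ l₀ * m₁ - l₁ * m₀ = 0 := by
  obtain ⟨lam, mu, nu, e₀, e₁, e₂⟩ := hF2 _ _ _
    ((hl₁.mul hm₂).sub (hl₂.mul hm₁)) ((hl₂.mul hm₀).sub (hl₀.mul hm₂))
    ((hl₀.mul hm₁).sub (hl₁.mul hm₀)) h
  have hl : l₀ * (l₁ * m₂ - l₂ * m₁) + l₁ * (l₂ * m₀ - l₀ * m₂) + l₂ * (l₀ * m₁ - l₁ * m₀) = 0 := by ring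
  have hm : m₀ * (l₁ * m₂ - l₂ * m₁) + m₁ * (l₂ * m₀ - l₀ * m₂) + m₂ * (l₀ * m₁ - l₁ * m₀) = 0 := by ring
  rw [e₀, e₁, e₂] at hl hm
  obtain ⟨hl1, hl2, hl3⟩ := hF1 (-(C lam * l₁) - C mu * l₂) (C lam * l₀ - C nu * l₂)
    (C mu * l₀ + C nu * l₁) ((hl₁.C_mul _).neg.sub (hl₂.C_mul _))
    ((hl₀.C_mul _).sub (hl₂.C_mul _)) ((hl₀.C_mul _).add (hl₁.C_mul _))
    (by linear_combination hl)
  obtain ⟨hm1, hm2, hm3⟩ := hF1 (-(C lam * m₁) - C mu * m₂) (C lam * m₀ - C nu * m₂)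
    (C mu * m₀ + C nu * m₁) ((hm₁.C_mul _).neg.sub (hm₂.C_mul _))
    ((hm₀.C_mul _).sub (hm₂.C_mul _)) ((hm₀.C_mul _).add (hm₁.C_mul _))
    (by linear_combination hm)
  have key : ∀ s : K, s ≠ 0 → C s * C s * (l₁ * m₂ - l₂ * m₁) = 0 →
      C s * C s * (l₂ * m₀ - l₀ * m₂) = 0 → C s * C s * (l₀ * m₁ - l₁ * m₀) = 0 →
      l₁ * m₂ - l₂ * m₁ = 0 ∧ l₂ * m₀ - l₀ * m₂ = 0 ∧ l₀ * m₁ - l₁ * m₀ = 0 := by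
    intro s hs h0 h1 h2
    have hCs : (C s : MvPolynomial σ K) * C s ≠ 0 :=
      mul_ne_zero (C_ne_zero.2 hs) (C_ne_zero.2 hs)
    exact ⟨(mul_eq_zero.1 h0).resolve_left hCs, (mul_eq_zero.1 h1).resolve_left hCs,
      (mul_eq_zero.1 h2).resolve_left hCs⟩
  by_cases hlam : lam ≠ 0
  · exact key lam hlam (by linear_combination (-(C lam * m₂)) * hl1 + (C lam * l₂) * hm1)
      (by linear_combination (-(C lam * m₂)) * hl2 + (C lam * l₂) * hm2)
      (by linear_combination (C nu * m₂) * hl1 - (C mu * m₂) * hl2 - (C lam * l₀) * hm1 -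
        (C lam * l₁) * hm2)
  by_cases hmu : mu ≠ 0
  · exact key mu hmu (by linear_combination (C mu * m₁) * hl1 - (C mu * l₁) * hm1)
      (by linear_combination (-(C mu * m₀)) * hl1 - (C mu * m₂) * hl3 - (C mu * l₁) * hm2)
      (by linear_combination (C mu * m₁) * hl3 - (C mu * l₁) * hm3)
  by_cases hnu : nu ≠ 0
  · exact key nu hnu
      (by linear_combination (C nu * m₁) * hl2 + (C nu * m₂) * hl3 + (C nu * l₀) * hm1)
      (by linear_combination (-(C nu * m₀)) * hl2 + (C nu * l₀) * hm2)
      (by linear_combination (-(C nu * m₀)) * hl3 + (C nu * l₀) * hm3)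
  push Not at hlam hmu hnu
  refine ⟨?_, ?_, ?_⟩
  · rw [e₀, hlam, hmu, map_zero]; ring
  · rw [e₁, hlam, hnu, map_zero]; ring
  · rw [e₂, hmu, hnu, map_zero]; ring

/-- Rank `≤ 1` is impossible, from (F3): if `Ā c = q` (linear `Ā`) and all `2 × 2` minors of `Ā`
through row `0` vanish, then the row `0` of `Ā` is zero, so `q 0 = 0`. [folklore] -/
theorem false_of_minor2_eq_zero_of_facts (q : Fin 3 → MvPolynomial σ K) (hq0 : q 0 ≠ 0)
    (hF3 : ∀ f g : MvPolynomial σ K, f.IsHomogeneous 1 → g.IsHomogeneous 1 →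
      q 0 * f = q 1 * g → g = 0)
    (A : Fin 3 → Fin 5 → MvPolynomial σ K) (hA : ∀ i s, (A i s).IsHomogeneous 1)
    (c : Fin 5 → MvPolynomial σ K)
    (hq : ∀ i, ∑ s, A i s * c s = q i)
    (hmin : ∀ s t, A 0 s * A 1 t - A 1 s * A 0 t = 0 ∧ A 0 s * A 2 t - A 2 s * A 0 t = 0) :
    False := by
  have hcol : ∀ s, A 0 s = 0 := by
    intro s
    have hq0' := hq 0
    have hq1' := hq 1
    simp only [Fin.sum_univ_five] at hq0' hq1'
    have e01 : q 0 * A 1 s = q 1 * A 0 s := by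
      linear_combination (-1 : MvPolynomial σ K) * A 1 s * hq0' + A 0 s * hq1' -
        c 0 * (hmin s 0).1 - c 1 * (hmin s 1).1 - c 2 * (hmin s 2).1 - c 3 * (hmin s 3).1 -
        c 4 * (hmin s 4).1
    exact hF3 _ _ (hA 1 s) (hA 0 s) e01
  refine hq0 ?_
  rw [← hq 0]
  exact Finset.sum_eq_zero fun s _ => by rw [hcol s, zero_mul]

/-- Rank `2` is impossible (F1, F2): if `Ā c = q` (linear `Ā`) and all `3 × 3` minors of `Ā` vanish,
then all `2 × 2` minors of `Ā` vanish. [folklore] -/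
theorem minor2_eq_zero_of_minor3_eq_zero_of_facts (q : Fin 3 → MvPolynomial σ K)
    (hF1 : ∀ l₀ l₁ l₂ : MvPolynomial σ K, l₀.IsHomogeneous 1 → l₁.IsHomogeneous 1 →
      l₂.IsHomogeneous 1 → l₀ * q 0 + l₁ * q 1 + l₂ * q 2 = 0 → l₀ = 0 ∧ l₁ = 0 ∧ l₂ = 0)
    (hF2 : ∀ n₀ n₁ n₂ : MvPolynomial σ K, n₀.IsHomogeneous 2 → n₁.IsHomogeneous 2 →
      n₂.IsHomogeneous 2 → n₀ * q 0 + n₁ * q 1 + n₂ * q 2 = 0 → ∃ lam mu nu : K,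
        n₀ = C lam * q 1 + C mu * q 2 ∧ n₁ = -(C lam * q 0) + C nu * q 2 ∧
        n₂ = -(C mu * q 0) - C nu * q 1)
    (A : Fin 3 → Fin 5 → MvPolynomial σ K) (hA : ∀ i s, (A i s).IsHomogeneous 1)
    (c : Fin 5 → MvPolynomial σ K) (hq : ∀ i, ∑ s, A i s * c s = q i)
    (h3 : ∀ t s s', A 0 t * (A 1 s * A 2 s' - A 2 s * A 1 s') +
      A 1 t * (A 2 s * A 0 s' - A 0 s * A 2 s') + A 2 t * (A 0 s * A 1 s' - A 1 s * A 0 s') = 0) :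
    ∀ s s', A 1 s * A 2 s' - A 2 s * A 1 s' = 0 ∧ A 2 s * A 0 s' - A 0 s * A 2 s' = 0 ∧
      A 0 s * A 1 s' - A 1 s * A 0 s' = 0 := by
  intro s s'
  have hq0 := hq 0
  have hq1 := hq 1
  have hq2 := hq 2
  simp only [Fin.sum_univ_five] at hq0 hq1 hq2
  refine minors_eq_zero_of_cross_dot_eq_zero_of_facts q hF1 hF2 (A 0 s) (A 1 s) (A 2 s) (A 0 s')
    (A 1 s') (A 2 s') (hA 0 s) (hA 1 s) (hA 2 s) (hA 0 s') (hA 1 s') (hA 2 s') ?_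
  rw [← hq0, ← hq1, ← hq2]
  linear_combination c 0 * h3 0 s s' + c 1 * h3 1 s s' + c 2 * h3 2 s s' + c 3 * h3 3 s s' +
    c 4 * h3 4 s s'

/-- Rank `≤ 2` is impossible (F1–F3): `Ā c = q` with all `3 × 3` minors of `Ā` vanishing is
contradictory. [folklore] -/
theorem false_of_minor3_eq_zero_of_facts (q : Fin 3 → MvPolynomial σ K) (hq0 : q 0 ≠ 0)
    (hF1 : ∀ l₀ l₁ l₂ : MvPolynomial σ K, l₀.IsHomogeneous 1 → l₁.IsHomogeneous 1 →
      l₂.IsHomogeneous 1 → l₀ * q 0 + l₁ * q 1 + l₂ * q 2 = 0 → l₀ = 0 ∧ l₁ = 0 ∧ l₂ = 0)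
    (hF2 : ∀ n₀ n₁ n₂ : MvPolynomial σ K, n₀.IsHomogeneous 2 → n₁.IsHomogeneous 2 →
      n₂.IsHomogeneous 2 → n₀ * q 0 + n₁ * q 1 + n₂ * q 2 = 0 → ∃ lam mu nu : K,
        n₀ = C lam * q 1 + C mu * q 2 ∧ n₁ = -(C lam * q 0) + C nu * q 2 ∧
        n₂ = -(C mu * q 0) - C nu * q 1)
    (hF3 : ∀ f g : MvPolynomial σ K, f.IsHomogeneous 1 → g.IsHomogeneous 1 →
      q 0 * f = q 1 * g → g = 0)
    (A : Fin 3 → Fin 5 → MvPolynomial σ K) (hA : ∀ i s, (A i s).IsHomogeneous 1)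
    (c : Fin 5 → MvPolynomial σ K) (hq : ∀ i, ∑ s, A i s * c s = q i)
    (h3 : ∀ t s s', A 0 t * (A 1 s * A 2 s' - A 2 s * A 1 s') +
      A 1 t * (A 2 s * A 0 s' - A 0 s * A 2 s') + A 2 t * (A 0 s * A 1 s' - A 1 s * A 0 s') = 0) :
    False := by
  have hm := minor2_eq_zero_of_minor3_eq_zero_of_facts q hF1 hF2 A hA c hq h3
  refine false_of_minor2_eq_zero_of_facts q hq0 hF3 A hA c hq fun s t => ⟨?_, ?_⟩
  · linear_combination (hm s t).2.2
  · linear_combination (-1 : MvPolynomial σ K) * (hm s t).2.1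

/-- Expansion of a `3 × 3` minor of a `3 × 5` array along its first column (any commutative ring).
[folklore] -/
theorem det_submatrix_three' {R : Type*} [CommRing R] (A : Matrix (Fin 3) (Fin 5) R)
    (t s s' : Fin 5) :
    (A.submatrix id ![t, s, s']).det = A 0 t * (A 1 s * A 2 s' - A 2 s * A 1 s') +
      A 1 t * (A 2 s * A 0 s' - A 0 s * A 2 s') + A 2 t * (A 0 s * A 1 s' - A 1 s * A 0 s') := by
  rw [Matrix.det_fin_three]
  simp only [Matrix.submatrix_apply, id_eq, Matrix.cons_val_zero, Matrix.cons_val_one,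
    Matrix.cons_val]
  ring

/-- **THE ENGINE.**  For any triple of quadrics `q` in `K[σ]` with `q 0 ≠ 0` satisfying
(F1) no linear syzygy, (F2) Koszul quadratic syzygies, (F3) `q 0 f = q 1 g` (linear `f, g`) forces
`g = 0`, there are no LINEAR `Ā ∈ K[σ]₁^{3×5}`, `C̄ ∈ K[σ]₁^{5×3}` and `a, c ∈ K[σ]⁵` with `Ā C̄ = 0`,
`Ā c = q`, `aᵀ C̄ = qᵀ`.  (Sylvester over `Frac K[σ]`: `rk Ā + rk C̄ ≤ 5`; ranks `≤ 2` are excluded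
by `false_of_minor3_eq_zero_of_facts` on `Ā` and on `C̄ᵀ`.)  This is the bordered-matrix step of
every remaining case of CASE A (`G|_W = [[0,qᵀ],[q,0]] = ÂĈ` on a linear section `W`). [folklore] -/
theorem false_of_G1_blocks_of_facts (q : Fin 3 → MvPolynomial σ K) (hq0 : q 0 ≠ 0)
    (hF1 : ∀ l₀ l₁ l₂ : MvPolynomial σ K, l₀.IsHomogeneous 1 → l₁.IsHomogeneous 1 →
      l₂.IsHomogeneous 1 → l₀ * q 0 + l₁ * q 1 + l₂ * q 2 = 0 → l₀ = 0 ∧ l₁ = 0 ∧ l₂ = 0)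
    (hF2 : ∀ n₀ n₁ n₂ : MvPolynomial σ K, n₀.IsHomogeneous 2 → n₁.IsHomogeneous 2 →
      n₂.IsHomogeneous 2 → n₀ * q 0 + n₁ * q 1 + n₂ * q 2 = 0 → ∃ lam mu nu : K,
        n₀ = C lam * q 1 + C mu * q 2 ∧ n₁ = -(C lam * q 0) + C nu * q 2 ∧
        n₂ = -(C mu * q 0) - C nu * q 1)
    (hF3 : ∀ f g : MvPolynomial σ K, f.IsHomogeneous 1 → g.IsHomogeneous 1 →
      q 0 * f = q 1 * g → g = 0)
    (Ā : Matrix (Fin 3) (Fin 5) (MvPolynomial σ K)) (Cb : Matrix (Fin 5) (Fin 3) (MvPolynomial σ K))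
    (a c : Fin 5 → MvPolynomial σ K)
    (hĀ : ∀ i s, (Ā i s).IsHomogeneous 1) (hCb : ∀ s i, (Cb s i).IsHomogeneous 1)
    (h0 : Ā * Cb = 0) (hc : Ā.mulVec c = fun i => q i) (ha : Matrix.vecMul a Cb = fun i => q i) :
    False := by
  classical
  have hc' : ∀ i, ∑ s, Ā i s * c s = q i := fun i => by
    have := congr_fun hc i
    simpa [Matrix.mulVec, dotProduct] using this
  have ha' : ∀ i, ∑ s, Cb s i * a s = q i := fun i => by
    have := congr_fun ha i
    simpa [Matrix.vecMul, dotProduct, mul_comm] using this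
  by_cases H : ∀ t s s', Ā 0 t * (Ā 1 s * Ā 2 s' - Ā 2 s * Ā 1 s') +
      Ā 1 t * (Ā 2 s * Ā 0 s' - Ā 0 s * Ā 2 s') + Ā 2 t * (Ā 0 s * Ā 1 s' - Ā 1 s * Ā 0 s') = 0
  · exact false_of_minor3_eq_zero_of_facts q hq0 hF1 hF2 hF3 (fun i s => Ā i s) hĀ c hc' H
  push Not at H
  obtain ⟨t, s, s', hne⟩ := H
  rw [← det_submatrix_three'] at hne
  refine false_of_minor3_eq_zero_of_facts q hq0 hF1 hF2 hF3 (fun i s => Cb s i) (fun i s => hCb s i)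
    a ha' ?_
  intro t' u u'
  have := minor3_eq_zero_of_mul_eq_zero Ā Cb h0 ![t, s, s'] hne ![t', u, u']
  rw [Matrix.det_fin_three] at this
  simp only [Matrix.submatrix_apply, id_eq, Matrix.cons_val_zero, Matrix.cons_val_one,
    Matrix.cons_val] at this
  linear_combination this

end Summit.ValiantsHypothesis.LiftNullstellensatz

end
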